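import Literature.AnabelianGeometry.EtaleTheta.Discharge.Sec5UnitsConjFactorsThroughCnst
import Literature.AnabelianGeometry.EtaleTheta.Discharge.Sec5OriginClausesOfPushforward
import Literature.AnabelianGeometry.SemiGraphs.TemperedOpenMapping

/-!
# [EtTh] Lemma 5.8's factorisation binder `hfac` (GAP G-L2d4-1) at the genuine §5 data over `B^temp(Π^tp_X)⁰`, from
# Prop. 3.4 (ii) and the [FrdII] Ex. 1.3 (ii) identification of `D → D^cnst` (pp. 298, 300, 322, 331 / PDF pp. 72, 74, 96, 105)

Mochizuki, *The étale theta function and its Frobenioid-theoretic manifestations*, Publ. RIMS **45** (2009)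
[cite: MochizukiEtTh2009, Lem 5.8 p.331 (PDF p.105); §3 p.298 (PDF p.72); §5 p.322 (PDF p.96)].  abc-iut cell, layer L2 by
signature (seat abc-iut-w4-d008, gen 4).  PROOF-ONLY composition (0 definitions) of this seat's two files
`Discharge/Sec5UnitsConjFactorsThroughCnst.lean` (p432786: `hfac` ⟸ `Prop34Cnst` + `hcnst`, via Thm. 3.7 (iii)) and
`Discharge/Sec5OriginClausesOfPushforward.lean` (`hcnst` ⟸ the identification `e : tf.base ⋙ cnst ≅ aug_* ⋙ G` + `hYdd`), with the
openness of `aug : Π^tp_X ↠ G_K` that the push-forward needs SUPPLIED by abc-iut-L3's open mapping theorem for tempered groups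
(`TemperedArithmeticGroup.augIsOpenMap_holds`, `SemiGraphs/TemperedOpenMapping.lean`: every `TemperedArithmeticGroup` has open
augmentation): **`ThetaFrobenioid.hfac_ofConnectedTemperoidData_of_pushforward`** — the binder `hfac` of abc-iut-L2-d4's
`discrepancy_mem_OKxRootN` / `thm510_ii_iii_of_torsion` / Thm. 5.7 family files, at abc-iut-L2-t4's `ofConnectedTemperoidData`,
from: abc-iut-L2-t3's `Prop34Cnst T₀ cnst` (Prop. 3.4 (ii)), ANY identification `e` of the composite `D = B^temp(Π^tp_X)⁰ → D₀ →
D^cnst` with the push-forward along `aug` followed by any `G` ("the natural functor `D₀ → D^cnst` determined by `Π^tp_X ↠ G_K`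
[cf. [FrdII], Example 1.3, (ii)]", §3 p.298), and `hYdd` («`aug(ιX Π^tp_Ÿ̲)` exhausts `aug(ιX Π^tp_X̲)`», `Ÿ` geometrically connected
over `K = K̈`, §5 p.322).  So GAP G-L2d4-1 is CLOSED modulo {`Prop34Cnst`, `e`, `hYdd`} — an interface hypothesis structure of
record, a definitional identification, and one property of the §1/§2 group data.  HONEST FRAMING: kernel-checked composition; `tf` stays an abstract parameter; nothing of [EtTh] §5 asserted;
typed ≠ proved; no side taken on [IUTchIII] Cor. 3.12.
-/

noncomputable section

namespace Literature.AnabelianGeometry.EtaleTheta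

open CategoryTheory Opposite Literature.AlgebraicGeometry.Frobenioids Literature.AlgebraicGeometry.Frobenioids.QuasiTemperoid
  Literature.AnabelianGeometry.SemiGraphs Literature.AnabelianGeometry.SemiGraphs.GaloisObjects

universe u₀ v₀ u₁ v₁ w

namespace ThetaFrobenioid

variable {K : Type u₀} [Field K] {X : SemiGraphs.TemperedArithmeticGroup.{u₀} K} {D₀ : Type u₀} [Category.{v₀} D₀]
  {V : FrdIMonoidStub.{w}} {T₀ : RealifiedDivisorMonoids (D₀ := D₀) V}
  {VD : FrdICatStub.{u₀ + 1, u₀, w} (ConnectedPart (BTemp X.Pi))}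
  {tf : TemperedFrobenioid T₀ (ConnectedPart (BTemp X.Pi)) VD} {hZ : tf.monoidType = MonoidType.Z}
  {hP : ∀ A : (ConnectedPart (BTemp X.Pi))ᵒᵖ, IsPerfect (tf.Φ.carrier A)}
  {NH : Subgroup (Field.absoluteGaloisGroup K) → tf.category → ℕ+ → Prop} {A₀ : tf.category}
  {hA₀ : PreFrobenioid.IsFrobeniusTrivial tf.toElem A₀} {hA₀' : SemiGraphs.IsGaloisObj A₀.base.obj}
  {pullFrac : ∀ {A A' : (BiKummerSetting.mkOfConnectedTemperoid X tf hZ hP NH A₀ hA₀ hA₀').C} (_ : A' ⟶ A),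
    (BiKummerSetting.mkOfConnectedTemperoid X tf hZ hP NH A₀ hA₀ hA₀').biratUnits A →
      (BiKummerSetting.mkOfConnectedTemperoid X tf hZ hP NH A₀ hA₀ hA₀').biratUnits A'}
  {lv N : ℕ+} {T : ThetaEnvData.{max u₀ w} N}
  {θ : (BiKummerSetting.mkOfConnectedTemperoid X tf hZ hP NH A₀ hA₀ hA₀').biratUnits
    (BiKummerSetting.mkOfConnectedTemperoid X tf hZ hP NH A₀ hA₀ hA₀').Aodot}
  {Bl : (BiKummerSetting.mkOfConnectedTemperoid X tf hZ hP NH A₀ hA₀ hA₀').C}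
  {Pl : (BiKummerSetting.mkOfConnectedTemperoid X tf hZ hP NH A₀ hA₀ hA₀').FractionPair θ Bl}
  {Rl : (BiKummerSetting.mkOfConnectedTemperoid X tf hZ hP NH A₀ hA₀ hA₀').NthRoot θ Pl lv pullFrac}
  (h : ModelFrobenioid.Hypotheses tf.divisorMonoid tf.ratFnFunctor)
  (Q : FrobenioidTheta.ThetaSubquotientStub.{w} (ConnectedPart (BTemp X.Pi))) (odd_l : Odd (lv : ℕ))
  (R : (BiKummerSetting.mkOfConnectedTemperoid X tf hZ hP NH A₀ hA₀ hA₀').NthRoot Rl.root Rl.pair N pullFrac)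
  (ιX : T.PiX ≃ₜ* X.Pi) (K' : Type w) [Field K'] (constEmb : K'ˣ →* tf.biratUnitsModel R.BN)
  (constEmb_injective : Function.Injective constEmb)
  (hinvc : ∀ g : Aut R.AN.base,
    pull tf.divisorMonoid g.hom (ModelFrobenioid.div R.pair.num) = ModelFrobenioid.div R.pair.num)
  (hinvp : ∀ y : T.PiX, y ∈ T.PiYdd →
    pull tf.divisorMonoid ((BiKummerSetting.mkOfConnectedTemperoid X tf hZ hP NH A₀ hA₀ hA₀').galoisSurj R.AN.base
      R.αData.isGalois (ιX y)).hom (ModelFrobenioid.div R.pair.den) = ModelFrobenioid.div R.pair.den)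
  {Dcnst : Type u₁} [Category.{v₁} Dcnst] (cnst : D₀ ⥤ Dcnst)
  (G : ConnectedPart (BTemp (Field.absoluteGaloisGroup K)) ⥤ Dcnst)
  (e : tf.base ⋙ cnst ≅ QuasiTemperoid.pushforward X.aug.toMonoidHom X.aug_surjective X.augIsOpenMap_holds ⋙ G)

include h e in
/-- **GAP G-L2d4-1 (`hfac`) at the genuine §5 data over `B^temp(Π^tp_X)⁰` from `Prop34Cnst` + the [FrdII] Ex. 1.3 (ii)
identification of `D → D^cnst` + `hYdd`** (the push-forward along `aug` formed with abc-iut-L3's `augIsOpenMap_holds`): every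
`y ∈ Im(Π^tp_Y̲)` acts on `O^×(B_N)` through `s^⊓-gp_N` like some `h ∈ H_{B_N} = Im(Π^tp_Ÿ̲)` (Lemma 5.8 proof p.331: "`Π^tp_Y` [i.e.,
`G_K` …] acts").  Composition of `hfac_ofConnectedTemperoidData_of_cnst` (p432786) with `hcnst_ofConnectedTemperoidData_of_pushforward`
(p433787) at `haug := X.augIsOpenMap_holds`.
[cite: MochizukiEtTh2009, Lem 5.8 p.331 (PDF p.105); §3 p.298 (PDF p.72); §5 p.322 (PDF p.96)] -/
theorem hfac_ofConnectedTemperoidData_of_pushforward (hP34 : RealifiedDivisorMonoids.Prop34Cnst T₀ cnst)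
    (hYdd : ∀ y : T.PiX, ∃ k ∈ T.PiYdd, X.aug (ιX k) = X.aug (ιX y)) :
    ∀ y ∈ (ofConnectedTemperoidData h Q odd_l R ιX K' constEmb constEmb_injective hinvc hinvp).imPiY,
      ∃ k ∈ (ofConnectedTemperoidData h Q odd_l R ιX K' constEmb constEmb_injective hinvc hinvp).HB,
        ∀ u ∈ (ofConnectedTemperoidData h Q odd_l R ιX K' constEmb constEmb_injective hinvc hinvp).units
            (ofConnectedTemperoidData h Q odd_l R ιX K' constEmb constEmb_injective hinvc hinvp).BN,
          (ofConnectedTemperoidData h Q odd_l R ιX K' constEmb constEmb_injective hinvc hinvp).sgpCap y * u *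
              ((ofConnectedTemperoidData h Q odd_l R ιX K' constEmb constEmb_injective hinvc hinvp).sgpCap y)⁻¹ =
            (ofConnectedTemperoidData h Q odd_l R ιX K' constEmb constEmb_injective hinvc hinvp).sgpCap k * u *
              ((ofConnectedTemperoidData h Q odd_l R ιX K' constEmb constEmb_injective hinvc hinvp).sgpCap k)⁻¹ :=
  hfac_ofConnectedTemperoidData_of_cnst h Q odd_l R ιX K' constEmb constEmb_injective hinvc hinvp hP34
    (hcnst_ofConnectedTemperoidData_of_pushforward h Q odd_l R ιX K' constEmb constEmb_injective hinvc hinvp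
      X.augIsOpenMap_holds cnst G e hYdd)

end ThetaFrobenioid

end Literature.AnabelianGeometry.EtaleTheta

end
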